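import Literature.NumberTheory.Automorphic.SpreadPairDatum
import Literature.NumberTheory.Automorphic.CuspidalRepFiniteComponent
import Literature.NumberTheory.Automorphic.BorelStabilizerLattice
import HarnessLib

/-!
# Translating an intertwiner of level `K_f(𝔫)`: the level of `y · T` for `y` integral outside `S`

Topic `NumberTheory/Automorphic`; namespace `Literature.NumberTheory.Automorphic`. Theorems only (no
definition, no named fact). For the finite component `π_f ≅ M = ⋃_{U₀} Hom_{G_∞}(τ, Π^{U₀})`
(`CuspidalRepFiniteComponent`) of a cuspidal representation, translation `T ↦ y · T = R((1, y)) ∘ T`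
moves the level from `U₀` to `y U₀ y⁻¹` (`comp_mem_multiplicityModule`). For the bad-place data of
Corollaire (i)(b) of Mœglin–Waldspurger one needs a PRINCIPAL CONGRUENCE subgroup inside `y K_f(𝔫) y⁻¹`
with controlled support: if `y_w ∈ GL_n(𝒪_w)` for every `w ∉ S` (`S` finite), then
`K_f(𝔫 ∏_{v ∈ S} 𝔭_v^{r_v}) ≤ y K_f(𝔫) y⁻¹` for suitable depths `r_v`
(`exists_conj_mem_finitePrincipalCongruenceLevel`; at `w ∉ S` conjugation by an integral matrix preserves
`K_w(𝔫)`, at `v ∈ S` conjugation by `y_v` costs the depth `2 μ_v`, `q_v^{μ_v}` bounding the entries of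
`y_v^{±1}`, `exists_depth_conj_mem_valuedCongruenceSubgroup`), hence `y · T` has level
`K_f(𝔫 ∏_{v ∈ S} 𝔭_v^{r_v})` (`exists_finComponentRep_mem_archIntertwinersLevel`). (Bump (1997), §3.3;
Borel–Jacquet (1979), §4.6: levels of translates.) [folklore]

## References

* D. Bump, *Automorphic Forms and Representations* (1997), §3.3 [Bump1997].
* A. Borel, H. Jacquet, *Automorphic forms and automorphic representations*, Corvallis 1979, §4.6
  [BorelJacquetCorvallis1979].
-/

noncomputable section

open MeasureTheory Measure NumberField NumberField.mixedEmbedding IsDedekindDomain Matrix WithZero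
open scoped MatrixGroups InnerProductSpace Classical

namespace Literature.NumberTheory.Automorphic

attribute [local instance] adelicBorel borelSpace_adelic locallyCompactSpace_adelic secondCountableTopology_gl_adelic

set_option synthInstance.maxHeartbeats 200000

-- Mathlib idiom (Mathlib/Algebra/Lie/OfAssociative.lean): the commutator Lie ring on matrices (as in
-- `CuspidalRepFiniteComponent`)
attribute [local instance 100] LieRing.ofAssociativeRing

/-! ### Conjugating a deep congruence subgroup by an arbitrary local element -/

section LocalDepth

variable {F : Type*} [Field F] [Valued F ℤᵐ⁰] {m : Type*} [Fintype m] [DecidableEq m]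

omit [DecidableEq m] in
/-- Every matrix over a discretely valued field has entries of valuation `≤ exp μ` for some `μ ∈ ℕ`.
[folklore] -/
theorem exists_valued_entries_le_exp (A : Matrix m m F) : ∃ μ : ℕ, ∀ i j, Valued.v (A i j) ≤ exp (μ : ℤ) := by
  classical
  have key : ∀ x : F, ∃ k : ℤ, Valued.v x ≤ exp k := fun x => by
    by_cases hx : Valued.v x = 0
    · exact ⟨0, by rw [hx]; exact zero_le⟩
    · exact ⟨log (Valued.v x), by rw [exp_log hx]⟩
  choose k hk using key
  refine ⟨Finset.univ.sup fun i => Finset.univ.sup fun j => (k (A i j)).toNat, fun i j => (hk (A i j)).trans ?_⟩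
  rw [exp_le_exp]
  have h1 : k (A i j) ≤ ((k (A i j)).toNat : ℤ) := Int.self_le_toNat _
  have h2 : (k (A i j)).toNat ≤ Finset.univ.sup fun j => (k (A i j)).toNat :=
    Finset.le_sup (f := fun j => (k (A i j)).toNat) (Finset.mem_univ j)
  have h3 : (Finset.univ.sup fun j => (k (A i j)).toNat) ≤
      Finset.univ.sup fun i => Finset.univ.sup fun j => (k (A i j)).toNat :=
    Finset.le_sup (f := fun i => Finset.univ.sup fun j => (k (A i j)).toNat) (Finset.mem_univ i)
  exact h1.trans (by exact_mod_cast h2.trans h3)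

/-- **Conjugation by an arbitrary `g ∈ GL_m(F)` maps a deep enough congruence subgroup into a given
one**: there is `r` (twice a bound for the entries of `g^{±1}`) with `g⁻¹ K(exp(-r) ρ) g ≤ K(ρ)` for every
`ρ ≤ 1` (`g⁻¹ u g - 1 = g⁻¹ (u - 1) g` and the ultrametric bound). [folklore] -/
theorem exists_depth_conj_mem_valuedCongruenceSubgroup (g : GL m F) :
    ∃ r : ℕ, ∀ ρ : ℤᵐ⁰, ρ ≤ 1 → ∀ u ∈ valuedCongruenceSubgroup m (exp (-(r : ℤ)) * ρ),
      g⁻¹ * u * g ∈ valuedCongruenceSubgroup m ρ := by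
  obtain ⟨μ₁, hμ₁⟩ := exists_valued_entries_le_exp (g : Matrix m m F)
  obtain ⟨μ₂, hμ₂⟩ := exists_valued_entries_le_exp ((g⁻¹ : GL m F) : Matrix m m F)
  set μ : ℕ := max μ₁ μ₂ with hμ
  have hg : ∀ i j, Valued.v ((g : Matrix m m F) i j) ≤ exp (μ : ℤ) := fun i j =>
    (hμ₁ i j).trans (exp_le_exp.2 (by exact_mod_cast le_max_left μ₁ μ₂))
  have hg' : ∀ i j, Valued.v (((g⁻¹ : GL m F) : Matrix m m F) i j) ≤ exp (μ : ℤ) := fun i j =>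
    (hμ₂ i j).trans (exp_le_exp.2 (by exact_mod_cast le_max_right μ₁ μ₂))
  refine ⟨2 * μ, fun ρ hρ u hu => ?_⟩
  -- the key bound `|(g⁻¹ x g - 1)_{ij}| ≤ ρ` for `x ∈ K(exp(-2μ) ρ)`
  have key : ∀ x : GL m F, x ∈ valuedCongruenceSubgroup m (exp (-((2 * μ : ℕ) : ℤ)) * ρ) →
      ∀ i j, Valued.v ((((g⁻¹ * x * g : GL m F) : Matrix m m F) - 1) i j) ≤ ρ := by
    intro x hx i j
    have hmat : ((g⁻¹ * x * g : GL m F) : Matrix m m F) - 1 =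
        ((g⁻¹ : GL m F) : Matrix m m F) * ((x : Matrix m m F) - 1) * (g : Matrix m m F) := by
      rw [Matrix.mul_sub, Matrix.sub_mul, Matrix.mul_one, Units.inv_mul, Units.val_mul, Units.val_mul]
    rw [hmat]
    have h := valued_mul_apply_le (m := m) (valued_mul_apply_le (m := m) hg' hx.2.2) hg i j
    refine h.trans (le_of_eq ?_)
    have hexp : exp (μ : ℤ) * exp (-((2 * μ : ℕ) : ℤ)) * exp (μ : ℤ) = 1 := by
      rw [← exp_add, ← exp_add, ← exp_zero]
      congr 1
      push_cast
      ring
    calc exp (μ : ℤ) * (exp (-((2 * μ : ℕ) : ℤ)) * ρ) * exp (μ : ℤ)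
        = (exp (μ : ℤ) * exp (-((2 * μ : ℕ) : ℤ)) * exp (μ : ℤ)) * ρ := by ac_rfl
      _ = ρ := by rw [hexp, one_mul]
  have hint : ∀ x : GL m F, x ∈ valuedCongruenceSubgroup m (exp (-((2 * μ : ℕ) : ℤ)) * ρ) →
      ∀ i j, Valued.v (((g⁻¹ * x * g : GL m F) : Matrix m m F) i j) ≤ 1 := by
    intro x hx i j
    have h : ((g⁻¹ * x * g : GL m F) : Matrix m m F) i j =
        ((((g⁻¹ * x * g : GL m F) : Matrix m m F) - 1) i j) + (1 : Matrix m m F) i j := by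
      rw [Matrix.sub_apply, sub_add_cancel]
    rw [h]
    refine Valuation.map_add_le _ ((key x hx i j).trans hρ) ?_
    rw [Matrix.one_apply]
    split_ifs <;> simp
  have hu' : u⁻¹ ∈ valuedCongruenceSubgroup m (exp (-((2 * μ : ℕ) : ℤ)) * ρ) := inv_mem hu
  have e : (g⁻¹ * u * g)⁻¹ = g⁻¹ * u⁻¹ * g := by group
  refine ⟨hint u hu, fun i j => ?_, key u hu⟩
  rw [e]
  exact hint u⁻¹ hu' i j

end LocalDepth

/-! ### Conjugating a principal congruence subgroup by an element integral outside `S` -/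

section Conj

open BigHeckeGLn

variable {n : ℕ} {K : Type} [Field K] [NumberField K]

/-- **`K_f(𝔫 ∏_{v ∈ S} 𝔭_v^{r_v}) ≤ y K_f(𝔫) y⁻¹` for `y` integral outside `S`.** For
`y ∈ GL_n(𝔸_K^∞)` with `y_w ∈ GL_n(𝒪_w)` for every `w ∉ S` there are depths `r_v` such that, for every
`𝔫 ≠ 0`, `y⁻¹ u y ∈ K_f(𝔫)` whenever `u ∈ K_f(𝔫 ∏_{v ∈ S} 𝔭_v^{r_v})`. [folklore] -/
theorem exists_conj_mem_finitePrincipalCongruenceLevel (S : Finset (HeightOneSpectrum (𝓞 K)))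
    (y : FiniteAdelicGL n K)
    (hy : ∀ w ∉ S, BigHeckeGLn.localComponent n K w y ∈ valuedCongruenceSubgroup (Fin n) (1 : ℤᵐ⁰)) :
    ∃ r : HeightOneSpectrum (𝓞 K) → ℕ, ∀ {𝔫 : Ideal (𝓞 K)}, 𝔫 ≠ 0 →
      ∀ u ∈ finitePrincipalCongruenceLevel n K (spreadLevelIdeal 𝔫 r S.toList),
        y⁻¹ * u * y ∈ finitePrincipalCongruenceLevel n K 𝔫 := by
  classical
  choose r hr using fun v : HeightOneSpectrum (𝓞 K) =>
    exists_depth_conj_mem_valuedCongruenceSubgroup (BigHeckeGLn.localComponent n K v y)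
  refine ⟨r, fun {𝔫} h𝔫 u hu => ?_⟩
  have hnd : S.toList.Nodup := Finset.nodup_toList S
  change u ∈ (principalCongruenceLevel n K _).comap (GLn.ofFinite n K) at hu
  change y⁻¹ * u * y ∈ (principalCongruenceLevel n K 𝔫).comap (GLn.ofFinite n K)
  rw [mem_comap_principalCongruenceLevel_iff_localComponent] at hu ⊢
  intro v
  rw [map_mul, map_mul, map_inv]
  by_cases hv : v ∈ S
  · have huv := hu v
    rw [idealRadius_spreadLevelIdeal_of_mem h𝔫 r hnd (Finset.mem_toList.2 hv)] at huv
    exact hr v _ (idealRadius_le_one' (K := K) v 𝔫) _ huv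
  · have huv := hu v
    rw [idealRadius_spreadLevelIdeal_of_not_mem h𝔫 r (fun h => hv (Finset.mem_toList.1 h))] at huv
    have h := conj_mem_valuedCongruenceSubgroup (idealRadius_le_one' (K := K) v 𝔫) (inv_mem (hy v hv)) huv
    rwa [inv_inv] at h

/-- The prime divisors of `𝔫 ∏_{v ∈ S} 𝔭_v^{r_v}` are those of `𝔫` and the places of `S`. [folklore] -/
theorem mem_or_dvd_of_dvd_spreadLevelIdeal_toList {𝔫 : Ideal (𝓞 K)} (r : HeightOneSpectrum (𝓞 K) → ℕ)
    {S : Finset (HeightOneSpectrum (𝓞 K))} {v : HeightOneSpectrum (𝓞 K)}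
    (hv : v.asIdeal ∣ spreadLevelIdeal 𝔫 r S.toList) : v.asIdeal ∣ 𝔫 ∨ v ∈ S := by
  rcases mem_or_dvd_of_dvd_spreadLevelIdeal r hv with h | h
  · exact Or.inl h
  · exact Or.inr (Finset.mem_toList.1 h)

end Conj

/-! ### The level of a translated intertwiner -/

section Level

variable {n : ℕ} {K : Type} [Field K] [NumberField K]
  {μ : Measure (AdelicGroupData.gl n K).automorphicQuotient} [(AdelicGroupData.gl n K).IsAutomorphicMeasure μ]
  {hcpt : isCompact_glFiniteIntegralLevel n K}
  {E : Type*} [NormedAddCommGroup E] [InnerProductSpace ℂ E]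
  {τ : ContRepresentation ℂ (AutomorphyDatum.gl n K hcpt).arch.carrier E}
  {W : ContRepresentation.ClosedSubrep ((AdelicGroupData.gl n K).rightRegular μ)}

/-- **The level of a translate**: if `T ∈ Hom_{G_∞}(τ, Π^{U₀})` and `y⁻¹ U₁ y ≤ U₀`, then
`y · T ∈ Hom_{G_∞}(τ, Π^{U₁})`. [folklore] -/
theorem finComponentRep_mem_archIntertwinersLevel_of_conj {U₀ U₁ : Subgroup (GL (Fin n) (FiniteAdeleRing (𝓞 K) K))}
    (T : multiplicityModule hcpt τ W)
    (hT : (T : E →L[ℂ] (AdelicGroupData.gl n K).L2 μ) ∈ archIntertwinersLevel hcpt τ W U₀)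
    (y : GL (Fin n) (FiniteAdeleRing (𝓞 K) K)) (hU : ∀ u ∈ U₁, y⁻¹ * u * y ∈ U₀) :
    ((finComponentRep hcpt τ W y T : multiplicityModule hcpt τ W) : E →L[ℂ] (AdelicGroupData.gl n K).L2 μ) ∈
      archIntertwinersLevel hcpt τ W U₁ := by
  rw [← mem_fixedPoints_finComponentRep_iff, Representation.mem_fixedPoints] at hT ⊢
  intro u hu
  have h := hT (y⁻¹ * u * y) (hU u hu)
  have hyu : (u : GL (Fin n) (FiniteAdeleRing (𝓞 K) K)) * y = y * (y⁻¹ * u * y) := by group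
  calc finComponentRep hcpt τ W u (finComponentRep hcpt τ W y T)
      = finComponentRep hcpt τ W ((u : GL (Fin n) (FiniteAdeleRing (𝓞 K) K)) * y) T := by
        rw [map_mul]; rfl
    _ = finComponentRep hcpt τ W y (finComponentRep hcpt τ W (y⁻¹ * u * y) T) := by
        rw [hyu, map_mul]; rfl
    _ = finComponentRep hcpt τ W y T := by rw [h]

/-- **A translate by an element integral outside `S` has a principal congruence level supported on
`supp 𝔫 ∪ S`.** For `T ∈ Hom_{G_∞}(τ, Π^{K_f(𝔫)})`, `𝔫 ≠ 0`, and `y ∈ GL_n(𝔸_K^∞)` with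
`y_w ∈ GL_n(𝒪_w)` for all `w ∉ S`, the translate `y · T` lies in `Hom_{G_∞}(τ, Π^{K_f(𝔫')})` for
`𝔫' = 𝔫 ∏_{v ∈ S} 𝔭_v^{r_v}` with suitable depths. [folklore] -/
theorem exists_finComponentRep_mem_archIntertwinersLevel (S : Finset (HeightOneSpectrum (𝓞 K)))
    {𝔫 : Ideal (𝓞 K)} (h𝔫 : 𝔫 ≠ 0) (T : multiplicityModule hcpt τ W)
    (hT : (T : E →L[ℂ] (AdelicGroupData.gl n K).L2 μ) ∈
      archIntertwinersLevel hcpt τ W (finitePrincipalCongruenceLevel n K 𝔫))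
    (y : GL (Fin n) (FiniteAdeleRing (𝓞 K) K))
    (hy : ∀ w ∉ S, BigHeckeGLn.localComponent n K w y ∈ valuedCongruenceSubgroup (Fin n) (1 : ℤᵐ⁰)) :
    ∃ r : HeightOneSpectrum (𝓞 K) → ℕ,
      ((finComponentRep hcpt τ W y T : multiplicityModule hcpt τ W) : E →L[ℂ] (AdelicGroupData.gl n K).L2 μ) ∈
        archIntertwinersLevel hcpt τ W (finitePrincipalCongruenceLevel n K (spreadLevelIdeal 𝔫 r S.toList)) := by
  obtain ⟨r, hr⟩ := exists_conj_mem_finitePrincipalCongruenceLevel S y hy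
  exact ⟨r, finComponentRep_mem_archIntertwinersLevel_of_conj T hT y fun u hu => hr h𝔫 u hu⟩

end Level

end Literature.NumberTheory.Automorphic
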